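import Mathlib
import Summits.ResolutionOfSingularities.ResolutionOfSingularities.Theorems.WeightedInvariantLocalWeightedDropNCResRegimeLetterReading
import Summits.ResolutionOfSingularities.ResolutionOfSingularities.Theorems.WeightedInvariantLocalWeightedDropTOT2BridgePresentedExit

/-!
# `LocalWeightedDrop`, TOT2-LINE inner S-ASM (8): ADAPTERS between res-L1-w43-stub-2's straight presentations and the interface `PresBy`;
# the exit-reading hypothesis `hPx` of the (P)/(L) assemblies DISCHARGED

Crux item stmt-ResolutionOfSingularities-8899 `WeightedInvariant.LocalWeightedDrop` (route `ResolutionOfSingularities/WeightedInvariant`), ENGINE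
skeleton v33 (35b29332b4d99231), registered stubs `stub_regimePresented` (P) / `stub_regimeLetter` (L); TOT2-LINE v1.3 §3 (P1)/(Px).
[OURS · L1 W4.3 · chain w43 · seat res-L1-w43-lead-1 gen 5; def-free; on `…NCResPresentationDefs` (p545961) and res-L1-w43-stub-2's
`Decoration.hCol_of_presentation_of_not_inPoly` (…TOT2BridgePresentedExit, p545321).  Nothing here is a statement of any manuscript;
AI-produced, gate-checked, weaker than expert review.]

* `NCPoly.not_X_castSucc_dvd_monicGerm` — no `u`-letter divides `y^d + Σ A_j y^j` (the `y^d` coefficient is `1`);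
* `Decoration.strIdx_eq_last_of_mem_O` — in a straight presentation `Θ^*(f · ∏_O x_l) = H · (y^d + …)` every HISTORY letter is straightened
  to `y` (a history letter straightened to a `u`-axis would divide the monic germ);
* **`Decoration.presBy_of_straight`** — stub-2's format (`IsBPermissible δ Θ 𝟙`, «letters straightened to `y` are old», unit, equation) gives
  `PresBy δ d A N Θ` with `N :=` the set of `u`-axes hit by boundary letters; and `Decoration.old_of_presBy` — the converse reading;
* **`Decoration.hCol_of_presBy_of_not_inPoly`** — the hypothesis `hPx` of `regimePresented_of_pieces` / `regimeLetter_of_pieces`, PROVED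
  (`[IsAlgClosed k]`): a presented state (`PresBy δ d A N Θ`, `δ.c = d`, `2 ≤ o`) whose well-prepared label is outside the regime is in the apex
  column; `hPx_holds` — the same under the stubs' binders.
-/

set_option linter.dupNamespace false -- mandated namespace of this single-conjunct summit

noncomputable section

namespace Summit.ResolutionOfSingularities.ResolutionOfSingularities.Theorems

open Literature.AlgebraicGeometry.Resolution

/-! ## No `u`-letter divides the monic germ -/

namespace NCPoly

open MvPowerSeries

variable {k : Type} [Field k]

/-- **NO `u`-LETTER DIVIDES `y^d + Σ A_j(u) y^j`.** -/
theorem not_X_castSucc_dvd_monicGerm (d : ℕ) (A : Fin d → MvPowerSeries (Fin 2) k) (j : Fin 2) :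
    ¬ (X (Fin.castSucc j) : MvPowerSeries (Fin 3) k) ∣ monicGerm d A := by
  intro h
  have h0 := (X_dvd_iff.mp h) (Finsupp.single (Fin.last 2) d)
    (by rw [Finsupp.single_eq_of_ne (Fin.castSucc_lt_last j).ne])
  rw [coeff_single_last_monicGerm] at h0
  exact one_ne_zero h0

end NCPoly

namespace TameFourTupleDrop

open MvPowerSeries TOT2Near

variable {k : Type} [Field k]

namespace Decoration

variable {b : MvPowerSeries (Fin (2 + 1)) k} {δ : Decoration k 2} {Θ : Fin (2 + 1) → MvPowerSeries (Fin (2 + 1)) k}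
  {H : MvPowerSeries (Fin (2 + 1)) k} {d : ℕ} {A : Fin d → MvPowerSeries (Fin 2) k}

/-- **HISTORY LETTERS ARE STRAIGHTENED TO `y`.**  If `Θ` straightens every boundary letter and `Θ^*(f · ∏_{l∈O} x_l) = H · (y^d + Σ A_j y^j)`
with `H` a unit, then `strIdx Θ l = y` for every `l ∈ O`. -/
theorem strIdx_eq_last_of_mem_O (hperm : IsBPermissible δ Θ (fun _ => 1)) (hH : constantCoeff H ≠ 0)
    (hP : subst Θ (δ.f * ∏ l ∈ δ.O, X l) = H * NCPoly.monicGerm d A) {l : Fin (2 + 1)} (hl : l ∈ δ.O) :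
    strIdx Θ l = Fin.last 2 := by
  classical
  obtain ⟨u, hu, he⟩ := strIdx_spec (hperm.2.2.2 l (δ.O_subset hl))
  induction hj : strIdx Θ l using Fin.lastCases with
  | last => rfl
  | cast j =>
    exfalso
    rw [hj] at he
    -- `X (castSucc j) ∣ Θ l ∣ Θ^*(f · ∏_O x) = H · P`, hence `∣ P`
    have hdvd1 : (X (Fin.castSucc j) : MvPowerSeries (Fin 3) k) ∣ subst Θ (δ.f * ∏ l' ∈ δ.O, X l') := by
      rw [← Finset.mul_prod_erase δ.O (fun l' => (X l' : MvPowerSeries (Fin (2 + 1)) k)) hl, ← mul_assoc, mul_comm δ.f, mul_assoc]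
      have ha := hasSubst_of_constantCoeff_zero hperm.1.1
      rw [← coe_substAlgHom ha, map_mul, coe_substAlgHom ha, subst_X ha]
      rw [he]
      exact Dvd.dvd.mul_right (Dvd.intro_left u rfl) _
    rw [hP] at hdvd1
    have hHunit : IsUnit H := by
      rw [MvPowerSeries.isUnit_iff_constantCoeff]; exact isUnit_iff_ne_zero.mpr hH
    have hdvd2 : (X (Fin.castSucc j) : MvPowerSeries (Fin 3) k) ∣ NCPoly.monicGerm d A := by
      have h := Dvd.dvd.mul_left hdvd1 (↑hHunit.unit⁻¹ : MvPowerSeries (Fin 3) k)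
      rwa [← mul_assoc, IsUnit.val_inv_mul, one_mul] at h
    exact NCPoly.not_X_castSucc_dvd_monicGerm d A j hdvd2

/-- **STUB-2's STRAIGHT PRESENTATION ⇒ `PresBy`** with `N :=` the `u`-axes hit by boundary letters. -/
theorem presBy_of_straight (hperm : IsBPermissible δ Θ (fun _ => 1)) (hOld : ∀ l ∈ δ.E, strIdx Θ l = Fin.last 2 → l ∈ δ.O)
    (hH : constantCoeff H ≠ 0) (hP : subst Θ (δ.f * ∏ l ∈ δ.O, X l) = H * NCPoly.monicGerm d A) :
    δ.PresBy d A ((Finset.univ : Finset (Fin 2)).filter fun j => ∃ l ∈ δ.E, l ∉ δ.O ∧ strIdx Θ l = Fin.castSucc j) Θ := by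
  classical
  refine ⟨hperm, fun l hl => strIdx_eq_last_of_mem_O hperm hH hP hl, fun l hlE hlO => ?_, fun j hj => ?_, H, hH, hP⟩
  · induction hj : strIdx Θ l using Fin.lastCases with
    | last => exact absurd (hOld l hlE hj) hlO
    | cast j => exact ⟨j, Finset.mem_filter.mpr ⟨Finset.mem_univ _, l, hlE, hlO, hj⟩, rfl⟩
  · obtain ⟨-, l, hlE, hlO, hl⟩ := Finset.mem_filter.mp hj
    exact ⟨l, hlE, hlO, hl⟩

/-- **`PresBy` ⇒ «letters straightened to `y` are old»** (stub-2's invariant). -/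
theorem old_of_presBy {N : Finset (Fin 2)} (hpres : δ.PresBy d A N Θ) {l : Fin (2 + 1)} (hlE : l ∈ δ.E)
    (hy : strIdx Θ l = Fin.last 2) : l ∈ δ.O := by
  by_contra hlO
  obtain ⟨j, -, hj⟩ := hpres.2.2.1 l hlE hlO
  rw [hj] at hy
  exact (Fin.castSucc_lt_last j).ne hy

/-- **THE EXIT READING `hPx`, PROVED.**  A presented state (`PresBy δ d A N Θ`, `δ.c = d`, `2 ≤ o`) whose well-prepared label is outside the regime
`Σ**` is in the apex column — res-L1-w43-stub-2's `hCol_of_presentation_of_not_inPoly` read through the interface. -/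
theorem hCol_of_presBy_of_not_inPoly [IsAlgClosed k] {N : Finset (Fin 2)} (hadm : Admissible b δ) (ho : 2 ≤ δ.o) (hcd : δ.c = d)
    (hpres : δ.PresBy d A N Θ) (hWP : PolyDescent.WellPrepared d A) (hn : ¬ PolyDescent.InPoly d A) : δ.HCol := by
  obtain ⟨hperm, -, -, -, U, hU, hP⟩ := hpres
  have hd : 0 < d := by
    rw [← hcd]
    exact lt_of_lt_of_le (by omega) (Nat.le_add_right δ.o δ.O.card)
  exact Decoration.hCol_of_presentation_of_not_inPoly hadm hperm.1.1 hperm.1.2.1 hperm.2.2.2 hU hd hP hcd ho hWP hn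

end Decoration

/-- **`hPx` UNDER THE STUBS' BINDERS** — the exit-reading hypothesis of `stub_regimePresented_of_pieces` / `stub_regimeLetter_of_pieces`. -/
theorem hPx_holds : ∀ (p : ℕ), p.Prime → ∀ (k : Type) [Field k] [CharP k p] [IsAlgClosed k],
    ∀ (b : MvPowerSeries (Fin 3) k) (δ : Decoration k 2) (d : ℕ) (A : Fin d → MvPowerSeries (Fin 2) k) (N : Finset (Fin 2))
      (Θ : Fin 3 → MvPowerSeries (Fin 3) k),
      Admissible b δ → 2 ≤ δ.o → δ.c = d → δ.PresBy d A N Θ → PolyDescent.WellPrepared d A → ¬ PolyDescent.InPoly d A → δ.HCol :=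
  fun _ _ _ _ _ _ _ _ _ _ _ _ hadm ho hcd hpres hWP hn => Decoration.hCol_of_presBy_of_not_inPoly hadm ho hcd hpres hWP hn

end TameFourTupleDrop

end Summit.ResolutionOfSingularities.ResolutionOfSingularities.Theorems

end
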